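import Summits.ResolutionOfSingularities.ResolutionOfSingularities.Theorems.HilbertSamuelEliminationSigmaMaxModificationsCorridor3WLadderTowerCompress
import Literature.AlgebraicGeometry.CossartJannsenSaito2020.BlowupTowerLocalizeDir
import HarnessLib

/-!
# Compressing a tower of blow-ups, II: `ℙ(Dir)` and step isomorphisms of the compressed tower
# — bookkeeping for CJS LNM 2270, Def. 6.38 (ii)′/(iv) read on a compressed localised chain tower

Stub worker res-L1-w42-stub-1 (gen 3), crux chain w42 (`SigmaMaxModifications` stmt-ResolutionOfSingularities-18506 / conjunct
stmt-…-19249); helper `--supports stmt-ResolutionOfSingularities-19249 --as helper`; kernel only, no named fact, no new definition.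
Sequel of `…Corridor3WLadderTowerCompress` for the RECOGNITION half of the units-half extraction (`Seg.UnitCentreDiscipline` of
`…Corridor3WLadderSegmentsExtract`, clauses `centre_one` and `iso`):

* `BlowupTower.projDir_compress_zero` — **`ℙ(Dir_x)` of the compressed tower (compression from stage `0`) is the preimage of `ℙ(Dir_x)`
  under the composite `hop` of the skipped (isomorphic) blow-ups**: `(T.compress 0 gap htriv).projDir x = (T.hop 0 (gap 0))⁻¹ (T.projDir x)`
  (the condition `IsOnProjDirectrix` only depends on the local homomorphism up to isomorphism — res-type-053's
  `mem_projDirectrixFibre_iff_of_isIso_stalkMap` along the square `hop ≫ π_1 = π'_1 ≫ 𝟙`).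
* `BlowupTower.compress_π_base` — pointwise form of the compressed projections.

OURS bookkeeping; NOT a statement of the manuscript [Hironaka2017] nor of [CossartJannsenSaito2020]. AI-written; AI review is weaker than
expert review.

References: V. Cossart, U. Jannsen, S. Saito, LNM 2270 (2020), Def. 6.34 (i), Def. 6.38 (ii), p. 107 [CossartJannsenSaito2020].
-/

noncomputable section

open CategoryTheory AlgebraicGeometry TopologicalSpace
open Literature.AlgebraicGeometry.Resolution

namespace Literature.AlgebraicGeometry.CossartJannsenSaito2020

universe u

namespace BlowupTower

variable (T : BlowupTower.{u})

/-- Pointwise form of the compressed projections: `π'_k(y) = π_{cidx k}(hop(y))`. [folklore] -/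
theorem compress_π_base {n₀ : ℕ} {gap : ℕ → ℕ} (htriv : ∀ k j, j < gap k → T.C (cidx n₀ gap k + j + 1) = ∅) (k : ℕ)
    (y : (T.compress n₀ gap htriv).X (k + 1)) :
    ((T.compress n₀ gap htriv).π k).base y = (T.π (cidx n₀ gap k)).base ((T.hop (cidx n₀ gap k) (gap k)).base y) :=
  rfl

/-- **`ℙ(Dir_x)` of the compressed tower** (compression from stage `0`): the preimage of `ℙ(Dir_x) ⊆ X_1` under the composite
`hop : X_{gap 0 + 1} ⟶ X_1` of the skipped isomorphic blow-ups. [cite: CossartJannsenSaito2020, Def. 6.34 (i), Def. 6.38 (ii), p. 107] -/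
theorem projDir_compress_zero {gap : ℕ → ℕ} (htriv : ∀ k j, j < gap k → T.C (cidx 0 gap k + j + 1) = ∅) (x : T.X 0) :
    (T.compress 0 gap htriv).projDir x = (T.hop 0 (gap 0)).base ⁻¹' T.projDir x := by
  haveI : IsLocallyNoetherian (T.X 0) := T.ln 0
  haveI : IsIso (T.hop 0 (gap 0)) := T.isIso_hop 0 (gap 0) (htriv 0)
  -- the square `hop ≫ π_1 = π'_1 ≫ 𝟙`, all read over `X_0`
  let π' : T.X (cidx 0 gap 1) ⟶ T.X 0 := (T.compress 0 gap htriv).π 0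
  have hsq : T.hop 0 (gap 0) ≫ T.π 0 = π' ≫ 𝟙 (T.X 0) := (Category.comp_id _).symm
  ext ξ
  have h1 : IsIso ((T.hop 0 (gap 0)).stalkMap ξ) := inferInstance
  have h2 : IsIso ((𝟙 (T.X 0) : T.X 0 ⟶ T.X 0).stalkMap (π'.base ξ)) := by
    rw [Scheme.Hom.stalkMap_id]
    exact ⟨⟨𝟙 _, Category.id_comp _, Category.id_comp _⟩⟩
  exact @mem_projDirectrixFibre_iff_of_isIso_stalkMap _ _ _ _ (T.ln 0) (T.ln 0) (T.π 0) π' (T.hop 0 (gap 0)) (𝟙 (T.X 0)) hsq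
    (fun _ _ h => h) x ξ h1 h2

end BlowupTower

end Literature.AlgebraicGeometry.CossartJannsenSaito2020

end
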